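import Summits.QuantumAdvantage.QuantumAdvantage.Theorems.CubicForrelationSignedExactCubicForrelationNotPrBPPStubRadicalGood

/-!
# Crux `CubicForrelation.SignedExactCubicForrelationNotPrBPP` (stmt-QuantumAdvantage-13932), line `dual-pingpong-frame`
# (classify-then-count cut): stub `stub_cubeKernelStats` — the cube block and the frame calculus

Support file 1/3 (`--supports stmt-QuantumAdvantage-13932`) for the registered stub `stub_cubeKernelStats` = KERNEL
STATISTICS OF THE CUBE TEMPLATE `b(y', y'') = y'·cube^k(y'') ⊕ h(y'')` at the pair `(0,0)` (proved in
`…StubCubeKernelStats.lean`). Everything is over `𝔽₂`, inner products spelled `(univ.filter fun i => uᵢ ∧ vᵢ).card.bodd`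
as registered; namespace `CubeKS`; no `Prop` definitions.

* The `𝔽₈` cube `cubeF` on ONE block `𝔽₂³` (the coordinates of the registered statement), its bilinear differential
  `Bc t u = cube(t ⊕ u) ⊕ cube t ⊕ cube u ⊕ cube 0`, and the two finite facts the statistics rest on, checked by `decide`
  over `𝔽₂³` in coordinates: `apn` — `B(t,u) = 0` with `t ≠ 0` forces `u ∈ {0, t}` (the Gold cube is APN), and `sep` —
  for distinct non-zero `t, u` only `a = 0` has `a·B(t,·) ≡ 0 ≡ a·B(u,·)` (`t ↦ ker B(t,·)ᵀ` is injective on `𝔽₈ ∖ 0`).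
* Block calculus on `𝔽₂^(k·3) = (𝔽₂³)^k` (`blk`, `glue`, `embed`, `bdot_embed_left/right`), the blockwise cube `cubeP`
  (literally the registered `π = cube^k`), and `B_(cube^k)` acting blockwise (`blk_Bv`, `Bv_embed`).
* The frame calculus of an MM-shaped `g(y', y'') = y'·π(y'') ⊕ h(y'')` for ARBITRARY `π` and `h` (no degree hypothesis,
  `h` cancels pairwise): `probe_unit` (`D_(u',0) D_x D_v g (0) = u'·B_π(x'', v'')`), `probe_pure`
  (`D_(0,w'') D_x D_(v',0) g (0) = v'·B_π(x'', w'')`), `d2_frame` (`D_x D_(v',0) g (z) = v'·(π z'' ⊕ π(z'' ⊕ x''))`) and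
  `d2_frame_frame` (the frame `Y' ⊕ 0` is flat: `D_(a,0) D_(c,0) g ≡ 0`).

References: K. Nyberg, *Differentially uniform mappings for cryptography*, EUROCRYPT '93, LNCS 765 (power maps
`x^(2^i+1)` are APN) [Nyberg1994]; C. Carlet, *Boolean Functions for Cryptography and Coding Theory*, CUP 2020, §5.2
(polar forms) and Prop. 54 (Maiorana–McFarland second derivatives, M-subspaces) [Carlet2020]. NOT here: the candidate
space / event / counting (`…Lemmas2.lean`), the arithmetic and the registered statement (`…StubCubeKernelStats.lean`). -/

noncomputable section

set_option linter.dupNamespace false -- D-0017: single-problem summit ⇒ `QuantumAdvantage.QuantumAdvantage` by design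

namespace Summit.QuantumAdvantage.QuantumAdvantage.Theorems.SignedExactCubicForrelationNotPrBPP

open Finset
open Literature.Computability.Complexity Literature.Computability.QuantumComplexity
open Literature.Computability.QuantumComplexity.BuzetChailloux (bxor zeroVec bxor_self bxor_comm
  bxor_zeroVec zeroVec_bxor bxor_bxor_cancel_left)
open PolarGeometry (bdot_comm bdot_bxor_left bdot_bxor_right bxor_bxor_assoc bxor_bxor_swap exists_append
  bxor_append xor_frame_eq)

namespace CubeKS

/-! ### The `𝔽₈` cube on one block `𝔽₂³` -/

/-- The cube map `x ↦ x³` of `𝔽₈` in coordinates. [folklore] -/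
def cubeF (x : Fin 3 → Bool) : Fin 3 → Bool :=
  ![x 0 ^^ x 1 ^^ x 2 ^^ (x 1 && x 2), (x 0 && x 1) ^^ (x 0 && x 2) ^^ x 1, (x 0 && x 1) ^^ x 2]

/-- The bilinear differential `B(t,u) = cube(t ⊕ u) ⊕ cube t ⊕ cube u ⊕ cube 0` of one block. [folklore] -/
def Bc (t u : Fin 3 → Bool) : Fin 3 → Bool :=
  fun s => cubeF (bxor t u) s ^^ cubeF t s ^^ cubeF u s ^^ cubeF zeroVec s

/-- The inner product bit on one block, as a formula. [folklore] -/
def bd3 (a w : Fin 3 → Bool) : Bool := (a 0 && w 0) ^^ (a 1 && w 1) ^^ (a 2 && w 2)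

/-- `zeroVec = ![false, false, false]`-type reading: a vector with all coordinates `false` is `0`. [folklore] -/
theorem eq_zeroVec_of3 {t : Fin 3 → Bool} (h0 : t 0 = false) (h1 : t 1 = false) (h2 : t 2 = false) :
    t = zeroVec := by
  funext s; fin_cases s
  · exact h0
  · exact h1
  · exact h2

/-- A non-zero `t : 𝔽₂³` has a `true` coordinate. [folklore] -/
theorem or3_of_ne_zeroVec {t : Fin 3 → Bool} (ht : t ≠ zeroVec) : (t 0 || t 1 || t 2) = true := by
  by_contra h
  apply ht
  apply eq_zeroVec_of3 <;> revert h <;> cases t 0 <;> cases t 1 <;> cases t 2 <;> decide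

/-- The inner product bit on `𝔽₂³` is the formula `bd3`. [folklore] -/
theorem bd3_eq (a w : Fin 3 → Bool) :
    (univ.filter fun s : Fin 3 => a s && w s).card.bodd = bd3 a w := by
  rw [Finset.card_filter, Fin.sum_univ_three, bd3]
  cases (a 0 && w 0) <;> cases (a 1 && w 1) <;> cases (a 2 && w 2) <;> rfl

/-- `B(t, 0) = 0`. [folklore] -/
theorem Bc_zero_right (t : Fin 3 → Bool) : Bc t zeroVec = zeroVec := by
  funext s
  show (cubeF (bxor t zeroVec) s ^^ cubeF t s ^^ cubeF zeroVec s ^^ cubeF zeroVec s) = false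
  rw [bxor_zeroVec]
  cases cubeF t s <;> cases cubeF zeroVec s <;> rfl

/-- APN, coordinate form (exhaustive check over `𝔽₂³ × 𝔽₂³`). [cite: Nyberg1994] -/
theorem apn_aux : ∀ t0 t1 t2 u0 u1 u2 : Bool, (t0 || t1 || t2) = true →
    Bc ![t0, t1, t2] ![u0, u1, u2] 0 = false → Bc ![t0, t1, t2] ![u0, u1, u2] 1 = false →
    Bc ![t0, t1, t2] ![u0, u1, u2] 2 = false →
    (u0 = false ∧ u1 = false ∧ u2 = false) ∨ (u0 = t0 ∧ u1 = t1 ∧ u2 = t2) := by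
  decide

/-- **The cube is APN**: for `t ≠ 0`, `B(t, u) = 0` only for `u ∈ {0, t}`. [cite: Nyberg1994] -/
theorem apn {t u : Fin 3 → Bool} (ht : t ≠ zeroVec) (hB : Bc t u = zeroVec) : u = zeroVec ∨ u = t := by
  have eta3 : ∀ w : Fin 3 → Bool, w = ![w 0, w 1, w 2] := fun w => by funext s; fin_cases s <;> rfl
  have h := apn_aux (t 0) (t 1) (t 2) (u 0) (u 1) (u 2) (or3_of_ne_zeroVec ht)
  rw [← eta3 t, ← eta3 u, hB] at h
  rcases h rfl rfl rfl with ⟨h0, h1, h2⟩ | ⟨h0, h1, h2⟩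
  · exact Or.inl (eq_zeroVec_of3 h0 h1 h2)
  · right; rw [eta3 u, eta3 t, h0, h1, h2]

/-- Separation, coordinate form (exhaustive check). [folklore] -/
theorem sep_aux : ∀ t0 t1 t2 u0 u1 u2 a0 a1 a2 : Bool, (t0 || t1 || t2) = true → (u0 || u1 || u2) = true →
    ((t0 ^^ u0) || (t1 ^^ u1) || (t2 ^^ u2)) = true →
    bd3 ![a0, a1, a2] (Bc ![t0, t1, t2] ![true, false, false]) = false →
    bd3 ![a0, a1, a2] (Bc ![t0, t1, t2] ![false, true, false]) = false →
    bd3 ![a0, a1, a2] (Bc ![t0, t1, t2] ![false, false, true]) = false →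
    bd3 ![a0, a1, a2] (Bc ![u0, u1, u2] ![true, false, false]) = false →
    bd3 ![a0, a1, a2] (Bc ![u0, u1, u2] ![false, true, false]) = false →
    bd3 ![a0, a1, a2] (Bc ![u0, u1, u2] ![false, false, true]) = false →
    (a0 = false ∧ a1 = false ∧ a2 = false) := by
  decide

/-- **Distinct non-zero `t, u` have disjoint left kernels**: if `a · B(t, ·) ≡ 0` and `a · B(u, ·) ≡ 0` then `a = 0`
(`t ↦ (Im B(t,·))^⊥` is injective on `𝔽₈ ∖ 0`). [folklore] -/
theorem sep {t u a : Fin 3 → Bool} (ht : t ≠ zeroVec) (hu : u ≠ zeroVec) (htu : t ≠ u)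
    (hat : ∀ w, bd3 a (Bc t w) = false) (hau : ∀ w, bd3 a (Bc u w) = false) : a = zeroVec := by
  have eta3 : ∀ w : Fin 3 → Bool, w = ![w 0, w 1, w 2] := fun w => by funext s; fin_cases s <;> rfl
  have hx : ((t 0 ^^ u 0) || (t 1 ^^ u 1) || (t 2 ^^ u 2)) = true := by
    by_contra hc
    apply htu
    rw [eta3 t, eta3 u]
    revert hc
    cases t 0 <;> cases t 1 <;> cases t 2 <;> cases u 0 <;> cases u 1 <;> cases u 2 <;> decide
  have h := sep_aux (t 0) (t 1) (t 2) (u 0) (u 1) (u 2) (a 0) (a 1) (a 2) (or3_of_ne_zeroVec ht)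
    (or3_of_ne_zeroVec hu) hx
  rw [← eta3 t, ← eta3 u, ← eta3 a] at h
  obtain ⟨h0, h1, h2⟩ := h (hat _) (hat _) (hat _) (hau _) (hau _) (hau _)
  exact eq_zeroVec_of3 h0 h1 h2

/-! ### Block calculus on `𝔽₂^(k·3) = (𝔽₂³)^k` -/

variable {k : ℕ}

/-- Block `q` of a vector of `𝔽₂^(k·3)`. [folklore] -/
def blk (w : Fin (k * 3) → Bool) (q : Fin k) : Fin 3 → Bool := fun s => w (finProdFinEquiv (q, s))

/-- Assemble a vector of `𝔽₂^(k·3)` from its blocks. [folklore] -/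
def glue (d : Fin k → Fin 3 → Bool) : Fin (k * 3) → Bool :=
  fun i => d (finProdFinEquiv.symm i).1 (finProdFinEquiv.symm i).2

/-- `blk (glue d) = d`. [folklore] -/
@[simp] theorem blk_glue (d : Fin k → Fin 3 → Bool) (q : Fin k) : blk (glue d) q = d q := by
  funext s
  show d (finProdFinEquiv.symm (finProdFinEquiv (q, s))).1 (finProdFinEquiv.symm (finProdFinEquiv (q, s))).2 = d q s
  rw [Equiv.symm_apply_apply]

/-- `glue (blk w) = w`. [folklore] -/
@[simp] theorem glue_blk (w : Fin (k * 3) → Bool) : glue (blk w) = w := by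
  funext i
  show w (finProdFinEquiv ((finProdFinEquiv.symm i).1, (finProdFinEquiv.symm i).2)) = w i
  rw [Prod.mk.eta, Equiv.apply_symm_apply]

/-- Two vectors with the same blocks are equal. [folklore] -/
theorem eq_of_blk_eq {w₁ w₂ : Fin (k * 3) → Bool} (h : ∀ q, blk w₁ q = blk w₂ q) : w₁ = w₂ := by
  rw [← glue_blk w₁, ← glue_blk w₂]
  exact congrArg glue (funext h)

/-- `blk` is additive (definitionally). [folklore] -/
theorem blk_bxor (u v : Fin (k * 3) → Bool) (q : Fin k) : blk (bxor u v) q = bxor (blk u q) (blk v q) := rfl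

/-- `blk 0 = 0` (definitionally). [folklore] -/
theorem blk_zeroVec (q : Fin k) : blk (zeroVec : Fin (k * 3) → Bool) q = zeroVec := rfl

/-- The vector supported on block `q` with value `c` there. [folklore] -/
def embed (q : Fin k) (c : Fin 3 → Bool) : Fin (k * 3) → Bool :=
  glue fun q' => if q' = q then c else zeroVec

/-- Blocks of `embed q c`. [folklore] -/
theorem blk_embed (q q' : Fin k) (c : Fin 3 → Bool) :
    blk (embed q c) q' = if q' = q then c else zeroVec := by
  unfold embed; rw [blk_glue]

/-- `blk (embed q c) q = c`. [folklore] -/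
@[simp] theorem blk_embed_self (q : Fin k) (c : Fin 3 → Bool) : blk (embed q c) q = c := by
  rw [blk_embed, if_pos rfl]

/-- Inner product against a one-block vector (right). [folklore] -/
theorem bdot_embed_right (v : Fin (k * 3) → Bool) (q : Fin k) (c : Fin 3 → Bool) :
    (univ.filter fun i => v i && embed q c i).card.bodd = bd3 (blk v q) c := by
  rw [← bd3_eq]
  congr 1
  have hinj : Function.Injective fun s : Fin 3 => finProdFinEquiv (q, s) := fun s s' h => by
    simpa using finProdFinEquiv.injective h
  rw [← Finset.card_map ⟨_, hinj⟩]
  congr 1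
  ext i
  simp only [Finset.mem_filter, Finset.mem_univ, true_and, Finset.mem_map, Function.Embedding.coeFn_mk]
  constructor
  · intro hi
    have he : embed q c i = true := by revert hi; cases v i <;> cases embed q c i <;> decide
    have hv : v i = true := by revert hi; cases v i <;> cases embed q c i <;> decide
    have he' : (if (finProdFinEquiv.symm i).1 = q then c else zeroVec) (finProdFinEquiv.symm i).2 = true := he
    by_cases hq : (finProdFinEquiv.symm i).1 = q
    · refine ⟨(finProdFinEquiv.symm i).2, ?_, ?_⟩
      · rw [if_pos hq] at he'
        have hv' : v (finProdFinEquiv (q, (finProdFinEquiv.symm i).2)) = true := by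
          rw [← hq, Prod.mk.eta, Equiv.apply_symm_apply]; exact hv
        show (blk v q (finProdFinEquiv.symm i).2 && c (finProdFinEquiv.symm i).2) = true
        rw [he', Bool.and_true]; exact hv'
      · show finProdFinEquiv (q, (finProdFinEquiv.symm i).2) = i
        rw [← hq, Prod.mk.eta, Equiv.apply_symm_apply]
    · rw [if_neg hq] at he'
      exact absurd he' (by simp [zeroVec])
  · rintro ⟨s, hs, rfl⟩
    have hc : c s = true := by revert hs; unfold blk; cases v _ <;> cases c s <;> decide
    have hv : v (finProdFinEquiv (q, s)) = true := by
      revert hs; unfold blk; cases v _ <;> cases c s <;> decide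
    rw [hv, Bool.true_and]
    show (glue fun q' => if q' = q then c else zeroVec) (finProdFinEquiv (q, s)) = true
    have := blk_glue (fun q' => if q' = q then c else zeroVec) q
    have h2 := congrFun this s
    simp only [blk, if_pos] at h2
    rw [h2]; simpa using hc

/-- Inner product against a one-block vector (left). [folklore] -/
theorem bdot_embed_left (q : Fin k) (a : Fin 3 → Bool) (w : Fin (k * 3) → Bool) :
    (univ.filter fun i => embed q a i && w i).card.bodd = bd3 a (blk w q) := by
  rw [bdot_comm, bdot_embed_right, ← bd3_eq, ← bd3_eq, bdot_comm]

/-! ### The blockwise cube `cube^k` and its bilinear differential -/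

/-- `cube^k`, written exactly as in the registered statement. [folklore] -/
def cubeP (k : ℕ) (y : Fin (k * 3) → Bool) : Fin (k * 3) → Bool :=
  fun i => cubeF (fun s => y (finProdFinEquiv ((finProdFinEquiv.symm i).1, s))) (finProdFinEquiv.symm i).2

/-- `cube^k` acts blockwise. [folklore] -/
theorem blk_cubeP (y : Fin (k * 3) → Bool) (q : Fin k) : blk (cubeP k y) q = cubeF (blk y q) := by
  show blk (glue fun q => cubeF (blk y q)) q = _
  rw [blk_glue]

/-- The bilinear differential `B_π(t, u) = π(t ⊕ u) ⊕ π t ⊕ π u ⊕ π 0` of a map `π`. [folklore] -/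
def Bv {m : ℕ} (π : (Fin m → Bool) → Fin m → Bool) (t u : Fin m → Bool) : Fin m → Bool :=
  fun i => π (bxor t u) i ^^ π t i ^^ π u i ^^ π zeroVec i

/-- `B_(cube^k)` acts blockwise as `Bc`. [folklore] -/
theorem blk_Bv (t u : Fin (k * 3) → Bool) (q : Fin k) :
    blk (Bv (cubeP k) t u) q = Bc (blk t q) (blk u q) := by
  funext s
  show (cubeP k (bxor t u) (finProdFinEquiv (q, s)) ^^ cubeP k t (finProdFinEquiv (q, s)) ^^
      cubeP k u (finProdFinEquiv (q, s)) ^^ cubeP k zeroVec (finProdFinEquiv (q, s))) = _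
  have e : ∀ y : Fin (k * 3) → Bool, cubeP k y (finProdFinEquiv (q, s)) = cubeF (blk y q) s :=
    fun y => congrFun (blk_cubeP y q) s
  rw [e, e, e, e]
  rfl

/-- `B_(cube^k)(t, ·)` maps a one-block vector to a one-block vector. [folklore] -/
theorem Bv_embed (t : Fin (k * 3) → Bool) (q : Fin k) (w : Fin 3 → Bool) :
    Bv (cubeP k) t (embed q w) = embed q (Bc (blk t q) w) := by
  refine eq_of_blk_eq fun q' => ?_
  rw [blk_Bv, blk_embed, blk_embed]
  by_cases h : q' = q
  · rw [if_pos h, if_pos h, h]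
  · rw [if_neg h, if_neg h, Bc_zero_right]


/-! ### Frame calculus of an MM-shaped `g(y', y'') = y'·π(y'') ⊕ h(y'')` (any `π`, any `h`) -/

section Frame

variable {m : ℕ} {g : (Fin (m + m) → Bool) → Bool} {π : (Fin m → Bool) → Fin m → Bool}
  {h : (Fin m → Bool) → Bool}

/-- `(0, 0) = 0`. [folklore] -/
theorem append_zeroVec : Fin.append (zeroVec : Fin m → Bool) (zeroVec : Fin m → Bool) = zeroVec :=
  Fin.append_castAdd_natAdd (f := (zeroVec : Fin (m + m) → Bool))

/-- Frame shift on the right of `⊕`: `g(y' ⊕ u', y'') = u'·π(y'') ⊕ g(y', y'')`. [cite: Carlet2020, Prop. 54] -/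
theorem frame_right
    (hg : ∀ y' y'' : Fin m → Bool,
      g (Fin.append y' y'') = ((Finset.univ.filter fun i => y' i && (π y'') i).card.bodd ^^ h y''))
    (y' y'' u' : Fin m → Bool) :
    g (Fin.append (bxor y' u') y'') =
      ((univ.filter fun i => u' i && π y'' i).card.bodd ^^ g (Fin.append y' y'')) := by
  have e := xor_frame_eq hg u' y' y''
  revert e
  cases g (Fin.append (bxor y' u') y'') <;> cases g (Fin.append y' y'') <;>
    cases (univ.filter fun i => u' i && π y'' i).card.bodd <;> decide

/-- Frame shift on the left of `⊕`: `g(u' ⊕ y', y'') = u'·π(y'') ⊕ g(y', y'')`. [folklore] -/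
theorem frame_left
    (hg : ∀ y' y'' : Fin m → Bool,
      g (Fin.append y' y'') = ((Finset.univ.filter fun i => y' i && (π y'') i).card.bodd ^^ h y''))
    (u' y' y'' : Fin m → Bool) :
    g (Fin.append (bxor u' y') y'') =
      ((univ.filter fun i => u' i && π y'' i).card.bodd ^^ g (Fin.append y' y'')) := by
  rw [bxor_comm]; exact frame_right hg y' y'' u'

/-- Frame shift from the origin: `g(u', y'') = u'·π(y'') ⊕ g(0, y'')`. [folklore] -/
theorem frame_zero
    (hg : ∀ y' y'' : Fin m → Bool,
      g (Fin.append y' y'') = ((Finset.univ.filter fun i => y' i && (π y'') i).card.bodd ^^ h y''))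
    (u' y'' : Fin m → Bool) :
    g (Fin.append u' y'') =
      ((univ.filter fun i => u' i && π y'' i).card.bodd ^^ g (Fin.append zeroVec y'')) := by
  rw [← frame_left hg u' zeroVec y'', bxor_zeroVec]

/-- `u·B_π(t, s) = u·π(t⊕s) ⊕ u·π(t) ⊕ u·π(s) ⊕ u·π(0)`. [folklore] -/
theorem bdot_Bv (u : Fin m → Bool) (t s : Fin m → Bool) :
    (univ.filter fun i => u i && Bv π t s i).card.bodd =
      ((univ.filter fun i => u i && π (bxor t s) i).card.bodd ^^ (univ.filter fun i => u i && π t i).card.bodd ^^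
        (univ.filter fun i => u i && π s i).card.bodd ^^ (univ.filter fun i => u i && π zeroVec i).card.bodd) := by
  rw [← bdot_bxor_right, ← bdot_bxor_right, ← bdot_bxor_right]
  rfl

/-- Boolean bookkeeping for `probe_unit`. [folklore] -/
theorem xor_cancel8 (A X V W p0 p1 p2 p3 : Bool) :
    ((A ^^ X ^^ V ^^ W) ^^ ((p0 ^^ A) ^^ (p1 ^^ X) ^^ (p2 ^^ V) ^^ (p3 ^^ W))) = (p3 ^^ p1 ^^ p2 ^^ p0) := by
  revert A X V W p0 p1 p2 p3; decide

/-- **Unit-frame test of a probe condition**: `D_(u',0) D_x D_v g (0) = u'·B_π(x'', v'')` for `x = (x', x'')`,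
`v = (v', v'')` — no hypothesis on `π` or `h`. [folklore] -/
theorem probe_unit
    (hg : ∀ y' y'' : Fin m → Bool,
      g (Fin.append y' y'') = ((Finset.univ.filter fun i => y' i && (π y'') i).card.bodd ^^ h y''))
    (x' x'' v' v'' u' : Fin m → Bool) :
    ((g zeroVec ^^ g (Fin.append x' x'') ^^ g (Fin.append v' v'') ^^
        g (bxor (Fin.append x' x'') (Fin.append v' v''))) ^^
      (g (Fin.append u' zeroVec) ^^ g (bxor (Fin.append u' zeroVec) (Fin.append x' x'')) ^^
        g (bxor (Fin.append u' zeroVec) (Fin.append v' v'')) ^^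
        g (bxor (Fin.append u' zeroVec) (bxor (Fin.append x' x'') (Fin.append v' v''))))) =
      (univ.filter fun i => u' i && Bv π x'' v'' i).card.bodd := by
  rw [← append_zeroVec]
  simp only [bxor_append, zeroVec_bxor]
  rw [frame_left hg u' x' x'', frame_left hg u' v' v'', frame_left hg u' (bxor x' v') (bxor x'' v''),
    frame_zero hg u' zeroVec, bdot_Bv]
  exact xor_cancel8 _ _ _ _ _ _ _ _

/-- Boolean bookkeeping for `probe_pure`. [folklore] -/
theorem xor_cancel8' (A X Y Z pa pb pc pd : Bool) :
    ((A ^^ X ^^ (pa ^^ A) ^^ (pb ^^ X)) ^^ (Y ^^ Z ^^ (pc ^^ Y) ^^ (pd ^^ Z))) = (pd ^^ pb ^^ pc ^^ pa) := by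
  revert A X Y Z pa pb pc pd; decide

/-- **Pure-`y''` test of a probe condition for a frame vector**: for `v = (v', 0)` and `x = (x', x'')`,
`D_(0,w'') D_x D_v g (0) = v'·B_π(x'', w'')` — no hypothesis on `π` or `h`. [folklore] -/
theorem probe_pure
    (hg : ∀ y' y'' : Fin m → Bool,
      g (Fin.append y' y'') = ((Finset.univ.filter fun i => y' i && (π y'') i).card.bodd ^^ h y''))
    (x' x'' v' w'' : Fin m → Bool) :
    ((g zeroVec ^^ g (Fin.append x' x'') ^^ g (Fin.append v' zeroVec) ^^
        g (bxor (Fin.append x' x'') (Fin.append v' zeroVec))) ^^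
      (g (Fin.append zeroVec w'') ^^ g (bxor (Fin.append zeroVec w'') (Fin.append x' x'')) ^^
        g (bxor (Fin.append zeroVec w'') (Fin.append v' zeroVec)) ^^
        g (bxor (Fin.append zeroVec w'') (bxor (Fin.append x' x'') (Fin.append v' zeroVec))))) =
      (univ.filter fun i => v' i && Bv π x'' w'' i).card.bodd := by
  rw [← append_zeroVec]
  simp only [bxor_append, zeroVec_bxor, bxor_zeroVec]
  rw [bxor_comm w'' x'', frame_zero hg v' zeroVec, frame_right hg x' x'' v', frame_zero hg v' w'',
    frame_right hg x' (bxor x'' w'') v', bdot_Bv]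
  exact xor_cancel8' _ _ _ _ _ _ _ _

/-- Boolean bookkeeping for `d2_frame`. [folklore] -/
theorem xor_cancel4 (P Q p1 p2 : Bool) : (P ^^ Q ^^ (p1 ^^ P) ^^ (p2 ^^ Q)) = (p1 ^^ p2) := by
  revert P Q p1 p2; decide

/-- **Second difference along a frame vector**: `D_x D_(v',0) g (z) = v'·(π(z'') ⊕ π(z'' ⊕ x''))`. [folklore] -/
theorem d2_frame
    (hg : ∀ y' y'' : Fin m → Bool,
      g (Fin.append y' y'') = ((Finset.univ.filter fun i => y' i && (π y'') i).card.bodd ^^ h y''))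
    (x' x'' v' z' z'' : Fin m → Bool) :
    (g (Fin.append z' z'') ^^ g (bxor (Fin.append z' z'') (Fin.append x' x'')) ^^
        g (bxor (Fin.append z' z'') (Fin.append v' zeroVec)) ^^
        g (bxor (Fin.append z' z'') (bxor (Fin.append x' x'') (Fin.append v' zeroVec)))) =
      (univ.filter fun i => v' i && bxor (π z'') (π (bxor z'' x'')) i).card.bodd := by
  simp only [bxor_append, bxor_zeroVec]
  rw [bxor_bxor_assoc z' x' v', frame_right hg z' z'' v', frame_right hg (bxor z' x') (bxor z'' x'') v',
    bdot_bxor_right]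
  exact xor_cancel4 _ _ _ _

/-- Boolean bookkeeping for `d2_frame_frame`. [folklore] -/
theorem xor_cancel4' (P pa pc : Bool) : (P ^^ (pa ^^ P) ^^ (pc ^^ P) ^^ (pc ^^ (pa ^^ P))) = false := by
  revert P pa pc; decide

/-- **The frame `Y' ⊕ 0` is flat**: `D_(a,0) D_(c,0) g ≡ 0` for every `h`. [cite: Carlet2020, Prop. 54] -/
theorem d2_frame_frame
    (hg : ∀ y' y'' : Fin m → Bool,
      g (Fin.append y' y'') = ((Finset.univ.filter fun i => y' i && (π y'') i).card.bodd ^^ h y''))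
    (a c x' x'' : Fin m → Bool) :
    (g (Fin.append x' x'') ^^ g (bxor (Fin.append x' x'') (Fin.append a zeroVec)) ^^
        g (bxor (Fin.append x' x'') (Fin.append c zeroVec)) ^^
        g (bxor (Fin.append x' x'') (bxor (Fin.append a zeroVec) (Fin.append c zeroVec)))) = false := by
  simp only [bxor_append, bxor_zeroVec]
  rw [bxor_bxor_assoc x' a c, frame_right hg x' x'' a, frame_right hg x' x'' c, frame_right hg (bxor x' a) x'' c,
    frame_right hg x' x'' a]
  exact xor_cancel4' _ _ _

end Frame

end CubeKS

/-- **Registered brick `cubeKS_frame_flat`** (helper 1/3 of stub `stub_cubeKernelStats`, line `dual-pingpong-frame`,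
crux stmt-QuantumAdvantage-13932): the frame `Y' ⊕ 0` of an MM-shaped `g(y', y'') = y'·π(y'') ⊕ h(y'')` is flat —
`D_(a,0) D_(c,0) g ≡ 0` for EVERY `π` and `h`. [cite: Carlet2020, Prop. 54] -/
theorem cubeKS_frame_flat : ∀ {m : ℕ} (g : (Fin (m + m) → Bool) → Bool) (π : (Fin m → Bool) → Fin m → Bool) (h : (Fin m → Bool) → Bool), (∀ y' y'' : Fin m → Bool, g (Fin.append y' y'') = (((Finset.univ.filter fun i => y' i && π y'' i).card).bodd ^^ h y'')) → ∀ a c x' x'' : Fin m → Bool, (g (Fin.append x' x'') ^^ g (bxor (Fin.append x' x'') (Fin.append a zeroVec)) ^^ g (bxor (Fin.append x' x'') (Fin.append c zeroVec)) ^^ g (bxor (Fin.append x' x'') (bxor (Fin.append a zeroVec) (Fin.append c zeroVec)))) = false :=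
  fun _ _ _ hg a c x' x'' => CubeKS.d2_frame_frame hg a c x' x''

end Summit.QuantumAdvantage.QuantumAdvantage.Theorems.SignedExactCubicForrelationNotPrBPP
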